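import Summits.KontsevichZagierPeriods.KontsevichZagierPeriods.Theses.HurwitzMicroSectors
import Summits.KontsevichZagierPeriods.KontsevichZagierPeriods.Theorems.HurwitzMicroSectorsNormalFormPrinciplePiBoxTransfer
import Summits.KontsevichZagierPeriods.KontsevichZagierPeriods.Theorems.HurwitzMicroSectorsNormalFormPrincipleVariants2340
import Summits.KontsevichZagierPeriods.KontsevichZagierPeriods.Theorems.HurwitzMicroSectorsNormalFormPrincipleVariants2349

/-! TTRL-lite variant V2352 of stmt-KontsevichZagierPeriods-3869

Variant V2352 = `stub_boxRigidity` (BoxRigidity: two box-rational representations — domain the open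
unit box, integrand `p/q` over `ℚ` — with equal values are KZ-equivalent) under the JOINT small-case
move `bound_nat:m≤3; bound_nat:m'≤3`. Verdict of the attempt seat: **open** — this file is the
exact-strength certificate, not a proof of the variant. V2352 is LITERALLY the right-hand side of the
tree's `stub_boxRigidity_var2340_iff_le_three` and `stub_boxRigidity_var2349_iff_boxRigidityLe_three`,
so it is the same statement as the recorded-open siblings V2340 (`m ≤ 3, m' ≤ 2`), V2349
(`m' = 3, m ≤ 2`), V2350 and V2239, namely **BoxVanishing in dimension `≤ 3`** (equivalently in
dimension exactly `3`, padding by unit intervals): every rational function over `ℚ` on `(0,1)^m`,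
`m ≤ 3`, absolutely integrable with integral `0`, is a Kontsevich–Zagier relation
(`stub_boxRigidity_var2352_iff_boxVanishingLe_three`, `stub_boxRigidity_var2352_iff_boxVanishing_three`).
That is Conjecture 1 for all box-rational periods of dimension `≤ 3`; already its dimension-`2` slice
contains the conclusion of `CatalanSectorTwoFour` (stmt-KontsevichZagierPeriods-3877) WITHOUT its open
hypothesis `LinearIndependent ℚ ![1, π², G]` (`sectorTwoFour_of_stub_boxRigidity_var2352`: for the pair
`[1/(1+x²y²)]`, value `G`, against a rational constant `[q]` the case split is `G = q`, irrationality
of Catalan's constant being open). On the other side `KontsevichZagierPeriods → V2352`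
(`stub_boxRigidity_var2352_of_statement`), so a refutation of the variant would refute the Summit; no
invariant of the four moves beyond `eval` is known. The proved two-sided slice is `m, m' ≤ 1`
(`stub_boxRigidity_var2352_slice_le_one`, Baker, sorry-free in tree).
Source: M. Kontsevich, D. Zagier, *Periods* (2001), §1.2 Conjecture 1 and rules 1)–3).
Pure proof file, no definitions. -/

-- `Summit.<Summit>.<Problem>` is the tree's mandated summit-side namespace (CONVENTIONS §2); for this
-- single-conjunct summit the two coincide, so the duplicate is deliberate.
set_option linter.dupNamespace false

noncomputable section

namespace Summit.KontsevichZagierPeriods.KontsevichZagierPeriods.Theorems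

open MeasureTheory Set
open Literature.NumberTheory.Transcendental Literature.NumberTheory.Transcendental.KZ
open Summit.KontsevichZagierPeriods.KontsevichZagierPeriods.Theses.HurwitzMicroSectors
open Summit.KontsevichZagierPeriods.HurwitzMicroSectors.NormalFormPrinciple.PiBox

/-! ## Exact strength: V2352 ⟺ BoxVanishing(dim ≤ 3) ⟺ BoxVanishing(3) -/

/-- **V2352 ⟺ BoxVanishing(dim ≤ 3)** (instance `j = k = 3` of `boxRigidityLe_iff_boxVanishingLe`):
the variant is exactly "every rational function over `ℚ` on `(0,1)^m`, `m ≤ 3`, absolutely integrable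
with integral `0`, is a KZ relation" — Conjecture 1 for all box-rational periods of dimension `≤ 3`,
open. [cite: KontsevichZagier2001, §1.2 Conjecture 1] -/
theorem stub_boxRigidity_var2352_iff_boxVanishingLe_three :
    (∀ (m m' : ℕ) (N : IntegralRep m) (N' : IntegralRep m'), m ≤ 3 → m' ≤ 3 → N.domain = {x | ∀ i, x i ∈ Set.Ioo (0:ℝ) 1} → N.IsRational → N'.domain = {x | ∀ i, x i ∈ Set.Ioo (0:ℝ) 1} → N'.IsRational → N.value = N'.value → Equivalent N N') ↔
    (∀ (m : ℕ) (N : IntegralRep m), m ≤ 3 → N.domain = {x | ∀ i, x i ∈ Set.Ioo (0:ℝ) 1} →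
      N.IsRational → N.value = 0 → of N ∈ relations) := by
  have h := boxRigidityLe_iff_boxVanishingLe 3 3
  rwa [max_self] at h

/-- **V2352 ⟺ BoxVanishing in dimension exactly `3`** (pad lower-dimensional representations to the
`3`-box by unit intervals, `boxRigidityLe_three_of_boxVanishing_three`).
[cite: KontsevichZagier2001, §1.2 Conjecture 1] -/
theorem stub_boxRigidity_var2352_iff_boxVanishing_three :
    (∀ (m m' : ℕ) (N : IntegralRep m) (N' : IntegralRep m'), m ≤ 3 → m' ≤ 3 → N.domain = {x | ∀ i, x i ∈ Set.Ioo (0:ℝ) 1} → N.IsRational → N'.domain = {x | ∀ i, x i ∈ Set.Ioo (0:ℝ) 1} → N'.IsRational → N.value = N'.value → Equivalent N N') ↔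
    (∀ (M : IntegralRep 3), M.domain = {x | ∀ i, x i ∈ Set.Ioo (0:ℝ) 1} → M.IsRational →
      M.value = 0 → of M ∈ relations) :=
  ⟨fun h M => (stub_boxRigidity_var2352_iff_boxVanishingLe_three.1 h) 3 M le_rfl,
    boxRigidityLe_three_of_boxVanishing_three⟩

/-- **V2352 ⟺ V2340** (`bound_nat:m≤3; bound_nat:m'≤2`, recorded open): the same statement.
[cite: KontsevichZagier2001, §1.2 Conjecture 1] -/
theorem stub_boxRigidity_var2352_iff_var2340 :
    (∀ (m m' : ℕ) (N : IntegralRep m) (N' : IntegralRep m'), m ≤ 3 → m' ≤ 3 → N.domain = {x | ∀ i, x i ∈ Set.Ioo (0:ℝ) 1} → N.IsRational → N'.domain = {x | ∀ i, x i ∈ Set.Ioo (0:ℝ) 1} → N'.IsRational → N.value = N'.value → Equivalent N N') ↔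
    (∀ (m m' : ℕ) (N : IntegralRep m) (N' : IntegralRep m'), m ≤ 3 → m' ≤ 2 → N.domain = {x | ∀ i, x i ∈ Set.Ioo (0:ℝ) 1} → N.IsRational → N'.domain = {x | ∀ i, x i ∈ Set.Ioo (0:ℝ) 1} → N'.IsRational → N.value = N'.value → Equivalent N N') :=
  stub_boxRigidity_var2340_iff_le_three.symm

/-- **V2352 ⟺ V2349** (`fix_nat:m'=3; bound_nat:m≤2`, recorded open): the same statement.
[cite: KontsevichZagier2001, §1.2 Conjecture 1] -/
theorem stub_boxRigidity_var2352_iff_var2349 :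
    (∀ (m m' : ℕ) (N : IntegralRep m) (N' : IntegralRep m'), m ≤ 3 → m' ≤ 3 → N.domain = {x | ∀ i, x i ∈ Set.Ioo (0:ℝ) 1} → N.IsRational → N'.domain = {x | ∀ i, x i ∈ Set.Ioo (0:ℝ) 1} → N'.IsRational → N.value = N'.value → Equivalent N N') ↔
    (∀ (m : ℕ) (N : IntegralRep m) (N' : IntegralRep 3), m ≤ 2 → N.domain = {x | ∀ i, x i ∈ Set.Ioo (0:ℝ) 1} → N.IsRational → N'.domain = {x | ∀ i, x i ∈ Set.Ioo (0:ℝ) 1} → N'.IsRational → N.value = N'.value → Equivalent N N') :=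
  stub_boxRigidity_var2349_iff_boxRigidityLe_three.symm

/-! ## What the variant contains unconditionally, and the proved slice -/

/-- **V2352 ⇒ Conjecture 1 on the level-`4` weight-`2` box sector, unconditionally** — verbatim the
conclusion of `CatalanSectorTwoFour` (stmt-KontsevichZagierPeriods-3877) WITHOUT its open hypothesis
`LinearIndependent ℚ ![1, π², G]`. [cite: KontsevichZagier2001, §1.2 Conjecture 1] -/
theorem sectorTwoFour_of_stub_boxRigidity_var2352
    (h : ∀ (m m' : ℕ) (N : IntegralRep m) (N' : IntegralRep m'), m ≤ 3 → m' ≤ 3 → N.domain = {x | ∀ i, x i ∈ Set.Ioo (0:ℝ) 1} → N.IsRational → N'.domain = {x | ∀ i, x i ∈ Set.Ioo (0:ℝ) 1} → N'.IsRational → N.value = N'.value → Equivalent N N') :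
    ∀ (r r' : IntegralRep 2) (P P' : Polynomial ℚ), r.domain = {x | ∀ i, x i ∈ Set.Ioo (0:ℝ) 1} → r'.domain = {x | ∀ i, x i ∈ Set.Ioo (0:ℝ) 1} → Set.EqOn r.integrand (fun x => Polynomial.aeval (x 0 * x 1) P / (1 - (x 0 * x 1) ^ 4)) r.domain → Set.EqOn r'.integrand (fun x => Polynomial.aeval (x 0 * x 1) P' / (1 - (x 0 * x 1) ^ 4)) r'.domain → r.value = r'.value → Equivalent r r' :=
  sectorTwoFour_of_stub_boxRigidity_var2349 (stub_boxRigidity_var2352_iff_var2349.1 h)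

/-- **The proved two-sided slice of V2352: `m, m' ≤ 1`** (Baker's theorem on linear forms in
logarithms, `boxRigidityLe_of_max_le_one`). [cite: KontsevichZagier2001, §1.2 Conjecture 1] -/
theorem stub_boxRigidity_var2352_slice_le_one :
    ∀ (m m' : ℕ) (N : IntegralRep m) (N' : IntegralRep m'), m ≤ 1 → m' ≤ 1 →
      N.domain = {x | ∀ i, x i ∈ Set.Ioo (0:ℝ) 1} → N.IsRational →
      N'.domain = {x | ∀ i, x i ∈ Set.Ioo (0:ℝ) 1} → N'.IsRational →
      N.value = N'.value → Equivalent N N' :=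
  boxRigidityLe_of_max_le_one 1 1 (by norm_num)

/-! ## The other side: the variant is implied by the parent leaf and by the Summit -/

/-- **The parent leaf ⇒ V2352** (specialisation; the converse is not claimed — the parent is
BoxVanishing in ALL dimensions, `boxRigidity_iff_forall_boxVanishingLe`).
[cite: KontsevichZagier2001, §1.2 Conjecture 1] -/
theorem stub_boxRigidity_var2352_of_parent
    (h : ∀ (m m' : ℕ) (N : IntegralRep m) (N' : IntegralRep m'), N.domain = {x | ∀ i, x i ∈ Set.Ioo (0:ℝ) 1} → N.IsRational → N'.domain = {x | ∀ i, x i ∈ Set.Ioo (0:ℝ) 1} → N'.IsRational → N.value = N'.value → Equivalent N N') :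
    ∀ (m m' : ℕ) (N : IntegralRep m) (N' : IntegralRep m'), m ≤ 3 → m' ≤ 3 → N.domain = {x | ∀ i, x i ∈ Set.Ioo (0:ℝ) 1} → N.IsRational → N'.domain = {x | ∀ i, x i ∈ Set.Ioo (0:ℝ) 1} → N'.IsRational → N.value = N'.value → Equivalent N N' :=
  fun m m' N N' _ _ => h m m' N N'

/-- **`KontsevichZagierPeriods ⇒ V2352`**: the variant is a special case of Conjecture 1 for the
tree's calculus (`leaves_of_statement`) — a refutation of the variant would refute the Summit.
[cite: KontsevichZagier2001, §1.2 Conjecture 1] -/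
theorem stub_boxRigidity_var2352_of_statement (h : _root_.KontsevichZagierPeriods) :
    ∀ (m m' : ℕ) (N : IntegralRep m) (N' : IntegralRep m'), m ≤ 3 → m' ≤ 3 → N.domain = {x | ∀ i, x i ∈ Set.Ioo (0:ℝ) 1} → N.IsRational → N'.domain = {x | ∀ i, x i ∈ Set.Ioo (0:ℝ) 1} → N'.IsRational → N.value = N'.value → Equivalent N N' :=
  stub_boxRigidity_var2352_of_parent (leaves_of_statement h).1

end Summit.KontsevichZagierPeriods.KontsevichZagierPeriods.Theorems
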